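import Summits.ValiantsHypothesis.ValiantsHypothesis.Theorems.MonotoneRestorationOrbitRestorationQPValueDerivationOps
import HarnessLib

/-!
# Value derivations are stable under equivariant affine-diagonal substitutions (symmetrisation in ORBIT currency)

Route MonotoneRestoration, crux `OrbitRestorationQP` (stmt-ValiantsHypothesis-18293), namespace
`Summit.ValiantsHypothesis.ValiantsHypothesis.Theorems.ValueDerivation`.

A substitution `φ : x ↦ w_x · x + a_x` (a `K`-algebra endomorphism of `K[X]` sending every variable to a scalar
multiple of itself plus a constant) that COMMUTES with the symmetries `Γ` of the variables transports a value
derivation `𝒟` (an ordinary straight-line computation recorded by its set of intermediate VALUES) to a value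
derivation containing `φ p` for every value `p` of `𝒟`, WITHOUT enlarging the bound on the `Γ`-orbits of the values:

* `exists_valueDerivation_subst` — the image derivation (values `𝒟.S ∪ {1} ∪ φ '' 𝒟.S`; a variable step becomes
  the weighted sum `w_x · x + a_x · 1`, the other steps are mapped along `φ`; ranks of new values are least ranks
  of preimages, stacked above `𝒟`);
* `exists_valueDerivation_scale` — the instance `x ↦ t · x` (diagonal scaling by one scalar `t`, which commutes
  with every renaming of the variables).

These are the transport lemmas used by the division theorem (`…ValueOrbitDivision.lean`: Strassen's division
elimination in orbit currency).  Everything is proved. [folklore]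
-/

noncomputable section

open scoped Classical

-- `Summit.ValiantsHypothesis.ValiantsHypothesis.…` is the tree's single-conjunct layout (Sub = Summit).
set_option linter.dupNamespace false

namespace Summit.ValiantsHypothesis.ValiantsHypothesis.Theorems

namespace ValueDerivation

universe u v w

variable {K : Type u} {X : Type v} [Field K]
variable {Γ : Type w} [Group Γ] [Fintype Γ] [MulAction Γ X]

/-- The orbit of the image of a value under an equivariant map is no larger than the orbit of the value.
[folklore] -/
theorem ncard_orbit_map_le (φ : MvPolynomial X K →ₐ[K] MvPolynomial X K)
    (hcomm : ∀ (γ : Γ) (q : MvPolynomial X K), ren γ (φ q) = φ (ren γ q)) (q : MvPolynomial X K) :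
    (Set.range fun γ : Γ => ren γ (φ q)).ncard ≤ (Set.range fun γ : Γ => ren γ q).ncard := by
  have h : (Set.range fun γ : Γ => ren γ (φ q)) = φ '' Set.range fun γ : Γ => ren γ q := by
    ext r
    simp only [Set.mem_range, Set.mem_image, exists_exists_eq_and, hcomm]
  rw [h]
  exact Set.ncard_image_le (Set.finite_range _)

/-- **EQUIVARIANT AFFINE-DIAGONAL SUBSTITUTION OF A VALUE DERIVATION.**  Let `φ` be a `K`-algebra endomorphism of
`K[X]` with `φ x = w_x · x + a_x` on variables, commuting with the renamings `ren γ`, `γ ∈ Γ`.  If every value of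
`𝒟` has `Γ`-orbit of size `≤ B` (`B ≥ 1`), then there is a value derivation containing `φ p` for every value `p`
of `𝒟`, all of whose values have `Γ`-orbits of size `≤ B`. [folklore] -/
theorem exists_valueDerivation_subst (φ : MvPolynomial X K →ₐ[K] MvPolynomial X K) (w a : X → K)
    (hφ : ∀ x, φ (MvPolynomial.X x) = MvPolynomial.C (w x) * MvPolynomial.X x + MvPolynomial.C (a x))
    (hcomm : ∀ (γ : Γ) (q : MvPolynomial X K), ren γ (φ q) = φ (ren γ q))
    (𝒟 : ValueDerivation K X) {B : ℕ} (hB : 1 ≤ B)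
    (hS : ∀ q ∈ 𝒟.S, (Set.range fun γ : Γ => ren γ q).ncard ≤ B) :
    ∃ 𝒟' : ValueDerivation K X, (∀ p ∈ 𝒟.S, φ p ∈ 𝒟'.S) ∧
      ∀ q ∈ 𝒟'.S, (Set.range fun γ : Γ => ren γ q).ncard ≤ B := by
  -- the new values, and least ranks of preimages
  set M := 𝒟.maxRank with hM
  let S' : Finset (MvPolynomial X K) := 𝒟.S ∪ insert (MvPolynomial.C 1) (𝒟.S.image φ)
  let pre : MvPolynomial X K → Set ℕ := fun r => {k | ∃ p ∈ 𝒟.S, φ p = r ∧ 𝒟.rank p = k}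
  let rk : MvPolynomial X K → ℕ := fun r =>
    if r ∈ 𝒟.S then 𝒟.rank r else if r = MvPolynomial.C 1 then 0 else M + 1 + sInf (pre r)
  have hrk_S : ∀ {r}, r ∈ 𝒟.S → rk r = 𝒟.rank r := fun hr => by simp only [rk, if_pos hr]
  have hrk_le_of_S : ∀ {r}, r ∈ 𝒟.S → rk r ≤ M := fun hr => by rw [hrk_S hr]; exact 𝒟.rank_le_maxRank hr
  have hrk_one_le : rk (MvPolynomial.C 1) ≤ M := by
    by_cases h1 : MvPolynomial.C 1 ∈ 𝒟.S
    · exact hrk_le_of_S h1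
    · simp only [rk, if_neg h1, if_true]; exact Nat.zero_le _
  have hrk_img_le : ∀ {u}, u ∈ 𝒟.S → rk (φ u) ≤ M + 1 + 𝒟.rank u := by
    intro u hu
    by_cases h1 : φ u ∈ 𝒟.S
    · exact (hrk_le_of_S h1).trans (by omega)
    by_cases h2 : φ u = MvPolynomial.C 1
    · rw [h2]; exact hrk_one_le.trans (by omega)
    simp only [rk, if_neg h1, if_neg h2]
    exact Nat.add_le_add_left (Nat.sInf_le (show 𝒟.rank u ∈ pre (φ u) from ⟨u, hu, rfl, rfl⟩)) _
  have hrk_new : ∀ {r}, r ∉ 𝒟.S → r ≠ MvPolynomial.C 1 → rk r = M + 1 + sInf (pre r) := fun h1 h2 => by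
    simp only [rk, if_neg h1, if_neg h2]
  -- membership helpers
  have memS' : ∀ {r}, r ∈ S' ↔ r ∈ 𝒟.S ∨ r = MvPolynomial.C 1 ∨ ∃ p ∈ 𝒟.S, φ p = r := by
    intro r
    simp only [S', Finset.mem_union, Finset.mem_insert, Finset.mem_image]
  have mem_of_S : ∀ {r}, r ∈ 𝒟.S → r ∈ S' := fun h => memS'.2 (Or.inl h)
  have one_mem : MvPolynomial.C 1 ∈ S' := memS'.2 (Or.inr (Or.inl rfl))
  have img_mem : ∀ {p}, p ∈ 𝒟.S → φ p ∈ S' := fun h => memS'.2 (Or.inr (Or.inr ⟨_, h, rfl⟩))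
  refine ⟨⟨S', rk, ?_⟩, fun p hp => img_mem hp, ?_⟩
  · -- every new value has a valid step
    intro r hr
    by_cases h1 : r ∈ 𝒟.S
    · obtain ⟨d, hd⟩ := 𝒟.step r h1
      refine ⟨d, ⟨hd.value_eq, fun u hu => ?_⟩⟩
      obtain ⟨huS, hlt⟩ := hd.args_lt u hu
      exact ⟨mem_of_S huS, by rw [hrk_S huS, hrk_S h1]; exact hlt⟩
    by_cases h2 : r = MvPolynomial.C 1
    · refine ⟨StepData.const 1, ⟨h2 ▸ rfl, fun u hu => ?_⟩⟩
      simp [StepData.args] at hu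
    -- `r = φ p` for a preimage `p` of least rank
    have hr' : ∃ p ∈ 𝒟.S, φ p = r := ((memS'.1 hr).resolve_left h1).resolve_left h2
    have hne : (pre r).Nonempty := by
      obtain ⟨p, hp, hpr⟩ := hr'
      exact ⟨_, p, hp, hpr, rfl⟩
    obtain ⟨p, hp, hpr, hprank⟩ := Nat.sInf_mem hne
    have hrk_r : rk r = M + 1 + 𝒟.rank p := by rw [hrk_new h1 h2, hprank]
    -- operands of the image step: images of operands of `p`'s step have smaller rank
    have hops : ∀ u ∈ 𝒟.S, 𝒟.rank u < 𝒟.rank p → φ u ∈ S' ∧ rk (φ u) < rk r := fun u hu hlt =>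
      ⟨img_mem hu, by rw [hrk_r]; exact (hrk_img_le hu).trans_lt (by omega)⟩
    obtain ⟨d, hd⟩ := 𝒟.step p hp
    have hval := hd.value_eq
    cases d with
    | var x =>
      -- `φ x = w_x · x + a_x · 1`
      refine ⟨StepData.sum ((w x, MvPolynomial.X x) ::ₘ {(a x, MvPolynomial.C 1)}), ⟨?_, fun u hu => ?_⟩⟩
      · simp only [StepData.value, Multiset.map_cons, Multiset.map_singleton, Multiset.sum_cons,
          Multiset.sum_singleton]
        rw [← hpr, ← hval]
        simp only [StepData.value, hφ, map_one, mul_one]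
      · simp only [StepData.args, Multiset.map_cons, Multiset.map_singleton, Multiset.mem_cons,
          Multiset.mem_singleton] at hu
        have hXp : MvPolynomial.X x = p := by rw [← hval]; rfl
        rcases hu with rfl | rfl
        · rw [hXp]
          exact ⟨mem_of_S hp, by rw [hrk_S hp, hrk_r]; omega⟩
        · exact ⟨one_mem, by rw [hrk_r]; exact hrk_one_le.trans_lt (by omega)⟩
    | const c =>
      refine ⟨StepData.const c, ⟨?_, fun u hu => ?_⟩⟩
      · rw [← hpr, ← hval]
        simp only [StepData.value, MvPolynomial.algHom_C, MvPolynomial.algebraMap_eq]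
      · simp [StepData.args] at hu
    | sum D =>
      refine ⟨StepData.sum (D.map fun cu => (cu.1, φ cu.2)), ⟨?_, fun u hu => ?_⟩⟩
      · rw [← hpr, ← hval]
        simp only [StepData.value, Multiset.map_map, Function.comp_def, map_multiset_sum, map_mul,
          MvPolynomial.algHom_C, MvPolynomial.algebraMap_eq]
      · simp only [StepData.args, Multiset.map_map, Function.comp_def, Multiset.mem_map] at hu
        obtain ⟨cu, hcu, rfl⟩ := hu
        have hmem : cu.2 ∈ (StepData.sum D : StepData K X).args := by
          simp only [StepData.args, Multiset.mem_map]
          exact ⟨cu, hcu, rfl⟩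
        obtain ⟨huS, hlt⟩ := hd.args_lt cu.2 hmem
        exact hops cu.2 huS hlt
    | prod u₁ u₂ =>
      refine ⟨StepData.prod (φ u₁) (φ u₂), ⟨?_, fun u hu => ?_⟩⟩
      · rw [← hpr, ← hval]
        simp only [StepData.value, map_mul]
      · simp only [StepData.args, Multiset.insert_eq_cons, Multiset.mem_cons,
          Multiset.mem_singleton] at hu
        have hm₁ : u₁ ∈ (StepData.prod u₁ u₂ : StepData K X).args := by simp [StepData.args]
        have hm₂ : u₂ ∈ (StepData.prod u₁ u₂ : StepData K X).args := by simp [StepData.args]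
        rcases hu with rfl | rfl
        · obtain ⟨huS, hlt⟩ := hd.args_lt u₁ hm₁
          exact hops u₁ huS hlt
        · obtain ⟨huS, hlt⟩ := hd.args_lt u₂ hm₂
          exact hops u₂ huS hlt
  · -- orbit bounds
    intro r hr
    rcases memS'.1 hr with h | rfl | ⟨p, hp, rfl⟩
    · exact hS r h
    · have h1 : (Set.range fun γ : Γ => ren γ (MvPolynomial.C (1 : K) : MvPolynomial X K)) =
          {MvPolynomial.C 1} := by
        ext q
        simp only [Set.mem_range, ren_C, Set.mem_singleton_iff, exists_const, eq_comm]
      rw [h1, Set.ncard_singleton]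
      exact hB
    · exact (ncard_orbit_map_le φ hcomm p).trans (hS p hp)

omit [Fintype Γ] in
/-- The diagonal scaling `x ↦ t · x` commutes with every renaming of the variables. [folklore] -/
theorem ren_scale_comm (t : K) (γ : Γ) (q : MvPolynomial X K) :
    ren γ (MvPolynomial.aeval (fun x : X => MvPolynomial.C t * MvPolynomial.X x) q) =
      MvPolynomial.aeval (fun x : X => MvPolynomial.C t * MvPolynomial.X x) (ren γ q) := by
  have h : (ren (K := K) γ).comp (MvPolynomial.aeval fun x : X => MvPolynomial.C t * MvPolynomial.X x) =
      (MvPolynomial.aeval fun x : X => MvPolynomial.C t * MvPolynomial.X x).comp (ren γ) := by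
    refine MvPolynomial.algHom_ext fun x => ?_
    simp only [AlgHom.comp_apply, MvPolynomial.aeval_X, map_mul, ren_X, ren_C]
  exact congrArg (fun ψ : MvPolynomial X K →ₐ[K] MvPolynomial X K => ψ q) h

/-- **SCALING A VALUE DERIVATION.**  If every value of `𝒟` has `Γ`-orbit of size `≤ B` (`B ≥ 1`), then for every
scalar `t` there is a value derivation containing `p(t·x)` for every value `p` of `𝒟`, with the same orbit bound.
[folklore] -/
theorem exists_valueDerivation_scale (t : K) (𝒟 : ValueDerivation K X) {B : ℕ} (hB : 1 ≤ B)
    (hS : ∀ q ∈ 𝒟.S, (Set.range fun γ : Γ => ren γ q).ncard ≤ B) :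
    ∃ 𝒟' : ValueDerivation K X,
      (∀ p ∈ 𝒟.S, MvPolynomial.aeval (fun x : X => MvPolynomial.C t * MvPolynomial.X x) p ∈ 𝒟'.S) ∧
      ∀ q ∈ 𝒟'.S, (Set.range fun γ : Γ => ren γ q).ncard ≤ B :=
  exists_valueDerivation_subst _ (fun _ => t) (fun _ => 0)
    (fun x => by simp only [MvPolynomial.aeval_X, map_zero, add_zero]) (ren_scale_comm t) 𝒟 hB hS

end ValueDerivation

end Summit.ValiantsHypothesis.ValiantsHypothesis.Theorems

end
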